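import Summits.QuantumFields.YangMills.Theorems.BalabanUVNodesN20ChiSemantics
import Summits.QuantumFields.YangMills.Theorems.BalabanUVNodesN21AveragedDatumRegularity
import Summits.QuantumFields.YangMills.Theorems.BalabanUVNodesN13Cor3Repr218LeavesAtRecord13CoPH
import Summits.QuantumFields.YangMills.Theorems.BalabanUVNodesN21StepWeightsPositivity
import Literature.MathematicalPhysics.QuantumFieldTheory.Balaban1983to89.Node00.Record13
import Literature.MathematicalPhysics.QuantumFieldTheory.Balaban1983to89.B15Claim189PinNonVacuity
import Literature.MathematicalPhysics.QuantumFieldTheory.Balaban1983to89.T4ExpWindowSmallField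

/-!
# BalabanUVNodes ∕ N13 — (UV₁₃)'s χ-DICTIONARY OFF THE SOLVABLE SETS OF RECORD: where the LOWER half of [Balaban1989LargeFieldII] (0.1) ∕ [Balaban1988Convergent]
# Cor. 3 (2.50), read at NODE 00's Stage-13 objects, is DISCHARGED by the vanishing of the (2.9) species; leaf (L1) of Cor. 3 at the record; what (2.17)'s
# character and `A^η` ARE off the (2.12)∕(0.21) solvable sets

Cell `pub-ymgap` (HUMAN RULING D-0062 Track A; D-0149 width seat `pub-ymgap-dag-n13-w1`, g2), key K1⁷ `StabilityBAtRecordR13SepCoPH` = stmt-QuantumFields-20542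
(`--kind proof --supports … --as helper`).  [I] = [Balaban1987RG1], [III] = [Balaban1988Convergent], [B16] = [Balaban1989LargeFieldII], [Av] = [Balaban1985Averaging].

WHY.  N13's (UV₁₃) row of the K1⁷ engines (dag-n12-d `…N12AtRecord13SepCoPHSockets.nodes₁₃CoPH_upS_fourPinW₀_pointed`, binder `hUV`; dag-n13-w3's (2.18)-leaves socket
`…N13Cor3Repr218LeavesAtRecord13CoPH` p592785) asks at every configuration `U` of `T^{(k)}` the LOWER inequality `χβ_k(U)·exp(−g_k⁻²A^η_k(U) − em|T₁^{(k)}|) ≤ ρ_k(U)`.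
THREE totalised solution maps of record sit inside it (chair R434 (c2): a minimiser in the regularity class when one exists, THE UNIT otherwise): the (2.9) species
`χβ_k = chiFix29OfRecord ν ε₂₉` reads def-B's `Uk K (k+1) εreg` through the critical configuration `V^{(k)}(Ū) = M^k(U_{k+1}(Ū))` ([I] (2.3)); `A^η_k = wilsonBGOfRecord εbg`
reads `Uk K k εbg`; (2.18)'s front factors `χ_k(s)` ([III] (2.17)) read def-R's cube-local `UminOfRecord`.  dag-n13-w3's LOCATED QUESTION (cell bus 2026-08-28T00:57Z,
`histTerm_pos_of_L2_of_chiβ_pos`): is `supp χβ_k ⊆ supp χ_k(s₀)`?  On the solvable branches the three choice-minimisers are related only by [15] Thm 1 — not in the tree —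
so undecidable there as typed.  THIS FILE decides what the kernel can, from [Av] Prop. 2 (52) ⇒ (54) (tree theorem `BlockAveragingEMLProp2`) and the junk defaults:
* §1 ★ `χβ_k` VANISHES AT EVERY `b₀`-FREE LARGE PLAQUETTE (`chiFix29OfRecord_eq_zero_of_plaquette_off_b0`): `|U(∂p) − 1| ≥ 2εreg + 4ε₁` at a plaquette none of whose bonds
  is a distinguished `b₀(c)` ⇒ `χ^{(2.9)}_k(U) = 0` ON BOTH BRANCHES (solvable: `V^{(k)}` is `2εreg∕L²`-plaquette-small by [Av] Prop. 2 via dag-n21-c's `plaqSmall_iter_Uk_level`;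
  junk: `V^{(k)} = M^k(1) = 1`; then `T4ExpWindowSmallField.dist1_plaqHol_le_add` forces a fluctuation variable `≥ ε₁` on `∂p`).  The (2.9) species DOES vanish on print's
  large-field locus — consistent with director-ym №126 C4 (i)'s currency.
* §2 `ρ_k ≥ 0` OF RECORD (`densOfRecord₁₃_nonneg`): the provisos' ζ-laws `Σζ = 1`, `Σ|ζ| ≤ 1` give `ζ ≥ 0` (dag-n21-d's `zetaOfRecord_nonneg`, by name), whence def-R's `slotsOfRecord_nonneg`.
* §3 ★★ THE LOWER HALF OF (UV₁₃) IS DISCHARGED ON THAT LOCUS (`uvLower_densOfRecord₁₃_of_plaquette_off_b0`), VERBATIM the `hUV` conjunct's shape, every `em`; the supplier's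
  BY-NAME JUNCTION `uvLower_of_smallLocus`: the lower inequality at ALL `U` follows from it on `{U : every b₀-free plaquette (2εreg + 4ε₂₉)-small}` — where [B16] Thm 1 ∕
  [III] Cor. 3's small-field content lives (nothing of it claimed).
* §4 (2.17) OF RECORD IS `1` OFF THE (2.12) SOLVABLE SETS (`chiOfRecord_eq_one_of_forall_not_solvable`, `chiSeqOfRecord_…`, `…_of_forall_largePlaquette`; dag-n20-d's
  `chiSmall_ukBox_eq_one_of_not_solvable` ∕ `dist1_plaqHol_lt_of_solvable` BY NAME over the cube catalogue): print's `χ_k(T_η)` read as `chiOfRecord` does NOT vanish at large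
  fields; and the TRIVIALITY REGIME `0 < εreg ≤ ε_k(g_k)` with `chiOfRecord ≡ 1` (excluded by the witnesses' `B₃·ε_k ≤ εreg`, `Record13LettersOfThm1CCMW`).
* §5 OFF def-B's LEVEL-`k` SOLVABLE SET (`wilsonBGOfRecord_eq_zero_of_le_dist1`, `uvLower_iff_of_le_dist1`): SOME plaquette (b₀-touching allowed) `≥ 2εbg` ⇒ `A^η_k(U) = 0`
  and the lower inequality READS `χβ_k(U)·e^{−em|T|} ≤ ρ_k(U)`; by §1 discharged unless every large plaquette of `U` touches a `b₀` bond — the residual thin locus where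
  `χβ_k(U)` is decided by def-B's level-`(k+1)` map at `Ū` (LOCATED, not decided; not a refutation).
* §6 PLUGS into p592785: `ρ_k ≥ 0` keyed on the core provisos (`densOfRecord₁₃_nonneg_of_provisos`); (L2)'s inequality ON THE LOCUS in the socket's letters
  (`leafL2_on_locus_of_provisos`).  Leaf (L1) at the record is dag-n13-w3's (INTENT-6 `…N13Cor3LeafL1AtRecord13CoPH`, keyed on `ζ ≥ 0`); dag-n21-d's
  `N21StepWeightsPositivity.zetaOfRecord_nonneg` (cited here, §2) supplies that `ζ ≥ 0` at EVERY parameter with `Provisos₁₃CoPH` (rows `zetaUnity`, `zetaAbs`).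

HONEST FRAMING.  Count-neutral kernel bookkeeping over landed objects + ONE printed estimate already in the tree ([Av] Prop. 2); nothing of Bałaban's asserted; [15]
Thm 1 NOT asserted (both branches treated); (UV₁₃) at `k ≥ 1` NOT supplied (only its large-field part — sign bookkeeping — and leaf (L1)); N13 NOT discharged;
K0⁷∕K1⁷ NOT closed; counts unmoved (5∕27 · A 5∕28); one finite `𝕋⁴_{L^K}` programme at fixed `ε = L^{−K}` — R4 closes the conditional finite-𝕋⁴ rung
`BalabanLadder.UV` only; the YM mass gap (Clay) is NOT proved by any of this.  No `def`, no `sorry`, no `instance`.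
-/

noncomputable section

open scoped BigOperators Matrix.Norms.L2Operator

namespace Summit.QuantumFields.YangMills.BalabanUVNodes.N13UVChiOffSolvableAtRecord13

open MeasureTheory
open Literature.MathematicalPhysics.QuantumFieldTheory.Balaban1983to89
open Literature.MathematicalPhysics.QuantumFieldTheory.Balaban1983to89.T4Continuum (T4Family)
open Literature.MathematicalPhysics.QuantumFieldTheory.Balaban1983to89.Node00
open B15DeterminingSets B14.Eq213DetSet B14.Eq216Concrete B14.Eq218Concrete B15Eq112TorusCover
open ExpMeanLog (deltaSU)
open Literature.MathematicalPhysics.QuantumFieldTheory.BalabanImbrieJaffe1984to88.BIJ85Eq453GaugeField (qsstarGIter0)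
open T4ExpWindowSmallField (plaqDev dist1_plaqHol_le_add)
open T4TiltOscillation (bdev)
open Summit.QuantumFields.YangMills.BalabanUVNodes.N20ChiSemantics (iter_avOfRecord_qsstarGIter0 chiSmall_ukBox_eq_one_of_not_solvable
  dist1_plaqHol_lt_of_solvable isMinimizer_ukBox_of_solvable)
open Summit.QuantumFields.YangMills.Theorems.N21AveragedDatumRegularity (plaqSmall_datum_of_ukExists plaqSmall_iter_Uk_level)
open Summit.QuantumFields.YangMills.Theorems.N21StepWeightsPositivity (zetaOfRecord_nonneg)

variable {F : T4Family} {N : ℕ} [NeZero N]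

/-! ## §1 The (2.9) species of record VANISHES at every `b₀`-free large plaquette (both branches of def-B's level-`(k+1)` solution map) -/

section Chi29

variable (ν : Stage7Numerics) {K k : ℕ}

/-- `M^k(1) = 1` for the averaging of record (`k ≤ m + K`): dag-n20-d's section property at the unit and `Q_k^{s*}1 = 1` (dag-n12-e). [cite: Balaban1987RG1, (0.4) p.253 (bookkeeping)] -/
theorem iter_avOfRecord_one (hk : k ≤ (F.P K).m + (F.P K).K) :
    Averaging.iter (avOfRecord F N K) k (1 : GaugeField (F.P K) 0 (SU N)) = 1 := by
  have h := iter_avOfRecord_qsstarGIter0 (F := F) (N := N) hk (1 : GaugeField (F.P K) k (SU N))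
  rwa [B15Claim189PinNonVacuity.qsstarGIter0_one] at h

/-- `(L^k·η_{k+1})² ≤ 1` (`= L^{−2}`). [cite: Balaban1987RG1, (0.1) p.251 (bookkeeping)] -/
theorem sq_pow_mul_eta_succ_le_one (K k : ℕ) : (((F.P K).L : ℝ) ^ k * (F.P K).eta (k + 1)) ^ 2 ≤ 1 := by
  have hL2 : (2 : ℝ) ≤ (F.P K).L := by exact_mod_cast (F.P K).hL.2
  have hL1 : (1 : ℝ) ≤ (F.P K).L := by linarith
  have hL0 : (0 : ℝ) < (F.P K).L := by linarith
  have hx : ((F.P K).L : ℝ) ^ k * (F.P K).eta (k + 1) = ((F.P K).L : ℝ)⁻¹ := by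
    rw [Params.eta, pow_succ, ← mul_assoc, ← mul_pow, mul_inv_cancel₀ hL0.ne', one_pow, one_mul]
  rw [hx]
  have h1 : ((F.P K).L : ℝ)⁻¹ ≤ 1 := inv_le_one_of_one_le₀ hL1
  have h0 : 0 ≤ ((F.P K).L : ℝ)⁻¹ := inv_nonneg.2 hL0.le
  nlinarith

/-- **THE CRITICAL CONFIGURATION OF RECORD IS `2εreg`-PLAQUETTE-SMALL ON BOTH BRANCHES** (`0 < εreg` in [Av] Prop. 2's range, `k ≤ m + K`): for every `W` on
`T^{(k+1)}`, `|V^{(k)}(W)(∂p) − 1| < 2εreg` at every plaquette of `T^{(k)}` — on def-B's solvable set `V^{(k)}(W) = M^k(U_{k+1}(W))` with `U_{k+1}(W)`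
`εreg·η_{k+1}²`-regular, so its `k`-fold average is `2εreg(L^kη_{k+1})² = 2εreg∕L²`-small ([Av] Prop. 2 (53), dag-n21-c's `plaqSmall_iter_Uk_level`); off it
`V^{(k)}(W) = M^k(1) = 1`. [cite: Balaban1985Averaging, Prop. 2 (52)–(54) p.26; Balaban1987RG1, (2.3) p.265] -/
theorem dist1_plaqHol_critCfgOfRecord_lt (hk : k ≤ (F.P K).m + (F.P K).K) (hε : 0 < ν.εreg)
    (hε3 : (143 * (((((F.P K).d + 4 : ℕ) : ℝ)) ^ 2 / 4) ^ 2) * ν.εreg ≤ 1 / 3)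
    (hε2 : 2 * ν.εreg ≤ 2 * deltaSU (Fin N) / ((((F.P K).d + 4) * (F.P K).L : ℕ) : ℝ) ^ 2)
    (W : GaugeField (F.P K) (k + 1) (SU N)) (p : Plaq (F.P K) k) :
    dist1 (GaugeField.plaqHol (critCfgOfRecord F N ν K k W) p) < 2 * ν.εreg := by
  by_cases h : UkExists F N K (k + 1) ν.εreg W
  · rw [critCfgOfRecord_def]
    have hs := plaqSmall_iter_Uk_level (F := F) (N := N) K (k + 1) hε hε3 hε2 h (j := k) (Nat.le_succ k) p
    refine lt_of_lt_of_le hs ?_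
    have h1 := sq_pow_mul_eta_succ_le_one (F := F) K k
    nlinarith
  · rw [critCfgOfRecord_of_not h, iter_avOfRecord_one hk, B15Chi124DetSets.plaqHol_one, GaugeGroup.dist1_one]
    linarith

/-- The (2.1) deviation profile summed over a plaquette is r-tower's `plaqDev` against the critical configuration (`rfl`). [cite: Balaban1987RG1, (2.1) p.265 (bookkeeping)] -/
theorem plaqDev_critCfg_eq_sum_fluctDev (V : GaugeField (F.P K) k (SU N)) (p : Plaq (F.P K) k) :
    plaqDev V (critCfgOfRecord F N ν K k ((avOfRecord F N K k).avg V)) p =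
      fluctDevOfRecord F N ν K k V ⟨p.src, p.μ⟩ + fluctDevOfRecord F N ν K k V ⟨p.src.shift p.μ, p.ν⟩ +
        fluctDevOfRecord F N ν K k V ⟨p.src.shift p.ν, p.μ⟩ + fluctDevOfRecord F N ν K k V ⟨p.src, p.ν⟩ := rfl

/-- **★ `χ^{(2.9)}_k` OF RECORD VANISHES AT EVERY `b₀`-FREE LARGE PLAQUETTE**: if the four bonds of `p` are not distinguished bonds `b₀(c)` and
`|V(∂p) − 1| ≥ 2εreg + 4ε₁`, then `chiFix29OfRecord ν ε₁ K k V = 0` — whichever branch def-B's level-`(k+1)` solution map takes at `V̄`. [cite: Balaban1987RG1, (2.9) p.266, (2.1)–(2.3) p.265; Balaban1985Averaging, Prop. 2 (54) p.26] -/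
theorem chiFix29OfRecord_eq_zero_of_plaquette_off_b0 (hk : k ≤ (F.P K).m + (F.P K).K) (hε : 0 < ν.εreg)
    (hε3 : (143 * (((((F.P K).d + 4 : ℕ) : ℝ)) ^ 2 / 4) ^ 2) * ν.εreg ≤ 1 / 3)
    (hε2 : 2 * ν.εreg ≤ 2 * deltaSU (Fin N) / ((((F.P K).d + 4) * (F.P K).L : ℕ) : ℝ) ^ 2)
    (ε₁ : ℝ) (V : GaugeField (F.P K) k (SU N)) (p : Plaq (F.P K) k)
    (h₁ : ¬ IsB0 (F := F) (⟨p.src, p.μ⟩ : PBond (F.P K) k)) (h₂ : ¬ IsB0 (F := F) (⟨p.src.shift p.μ, p.ν⟩ : PBond (F.P K) k))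
    (h₃ : ¬ IsB0 (F := F) (⟨p.src.shift p.ν, p.μ⟩ : PBond (F.P K) k)) (h₄ : ¬ IsB0 (F := F) (⟨p.src, p.ν⟩ : PBond (F.P K) k))
    (hbig : 2 * ν.εreg + 4 * ε₁ ≤ dist1 (GaugeField.plaqHol V p)) :
    chiFix29OfRecord F N ν ε₁ K k V = 0 := by
  rcases chiFix29OfRecord_eq_zero_or_one ν ε₁ K k V with h | h
  · exact h
  · exfalso
    rw [chiFix29OfRecord_eq_one_iff] at h
    have hcrit := dist1_plaqHol_critCfgOfRecord_lt (F := F) (N := N) ν hk hε hε3 hε2 ((avOfRecord F N K k).avg V) p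
    have hadd := dist1_plaqHol_le_add V (critCfgOfRecord F N ν K k ((avOfRecord F N K k).avg V)) p
    rw [plaqDev_critCfg_eq_sum_fluctDev] at hadd
    linarith [h _ h₁, h _ h₂, h _ h₃, h _ h₄]

end Chi29

/-! ## §2 `ρ_k ≥ 0` of record from the two ζ-laws of the provisos -/

section Nonneg

variable (θ : Stage13Params F N)

/-- **`ρ_k ≥ 0` OF RECORD** — `densOfRecord₁₃ θ P k = Σ_s χ_k(s)·slot_k(s)` with `χ_k(s) ≥ 0` and every post-𝐑 slot `≥ 0` at non-negative step weights
(def-R's `slotsOfRecord_nonneg`, def-T's `wOfRecord_nonneg`), the weights non-negative by the ζ-laws. [cite: Balaban1988Convergent, (2.18) p.257, (3.24) p.270; Balaban1989LargeFieldI, (0.3) p.176 (bookkeeping)] -/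
theorem densOfRecord₁₃_nonneg (hζu : IsZetaUnity F N θ.ν θ.τ9.M θ.ζ) (hζa : IsZetaAbsLeOne F N θ.ν θ.τ9.M θ.ζ) (P : B12.RunParams) (k : ℕ)
    (U : GaugeField (F.P P.K) k (SU N)) : 0 ≤ densOfRecord₁₃ F N θ P k U := by
  have hζ0 := zetaOfRecord_nonneg F N θ.ν θ.τ9.M hζu hζa
  show 0 ≤ ∑ s, _
  exact Finset.sum_nonneg fun s _ => mul_nonneg (chiSeqOfRecord_nonneg F N θ.ν θ.τ9.M _ P.K k s U)
    (slotsOfRecord_nonneg F N θ.ν θ.τ9 (EOfRecord₁₃ F N θ) (fun p' g' j s' U V' => wOfRecord_nonneg F N θ.ν θ.τ9.M p' g' j θ.A₁ hζ0 s' U V')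
      θ.ppSel P (gOfRecord₁₃ F N θ P) k s U)

/-- Every (2.18) history term `χ_k(s)(U)·slot_k(s)(U)` of record is `≥ 0` under the ζ-laws. [cite: Balaban1988Convergent, (2.18) p.257 (bookkeeping)] -/
theorem histTerm_nonneg (hζu : IsZetaUnity F N θ.ν θ.τ9.M θ.ζ) (hζa : IsZetaAbsLeOne F N θ.ν θ.τ9.M θ.ζ) (P : B12.RunParams) (k : ℕ)
    (s : SeqOfRecord F θ.ν θ.τ9.M (gOfRecord₁₃ F N θ P) P.K k) (U : GaugeField (F.P P.K) k (SU N)) :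
    0 ≤ chiSeqOfRecord F N θ.ν θ.τ9.M (gOfRecord₁₃ F N θ P) P.K k s U *
      slotsOfRecord F N θ.ν θ.τ9 (EOfRecord₁₃ F N θ) (wOfRecord₉ F N θ.toStage9Params) θ.ppSel P (gOfRecord₁₃ F N θ P) k s U :=
  mul_nonneg (chiSeqOfRecord_nonneg F N θ.ν θ.τ9.M _ P.K k s U)
    (slotsOfRecord_nonneg F N θ.ν θ.τ9 (EOfRecord₁₃ F N θ)
      (fun p' g' j s' U V' => wOfRecord_nonneg F N θ.ν θ.τ9.M p' g' j θ.A₁ (zetaOfRecord_nonneg F N θ.ν θ.τ9.M hζu hζa) s' U V') θ.ppSel P (gOfRecord₁₃ F N θ P) k s U)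

end Nonneg

/-! ## §3 ★★ The lower half of (UV₁₃) is DISCHARGED at every configuration with a `b₀`-free large plaquette -/

section Lower

variable (θ : Stage13Params F N)

/-- **★★ THE ENGINES' LOWER (UV₁₃) INEQUALITY HOLDS AT EVERY `U` WITH A `b₀`-FREE PLAQUETTE DEVIATING BY `≥ 2εreg + 4ε₂₉`**, for EVERY value `em` of the
world's dependence function and whatever `A^η_k(U)` is: the (2.9) species vanishes there (§1) and `ρ_k(U) ≥ 0` (§2).  VERBATIM the lower conjunct of `hUV` in
dag-n12-d's `nodes₁₃CoPH_upS_fourPinW₀_pointed` ∕ dag-n24-c's four-pin family at `θ.toStage13Params`-level objects.  Hypotheses: `0 < εreg` in [Av] Prop. 2's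
range, the ζ-laws, `k ≤ m + K`.  The large-field part of [B16] (0.1)'s lower bound is thus SIGN BOOKKEEPING at the record; the content is on the complement.
[cite: Balaban1989LargeFieldII, (0.1) pp.355–356; Balaban1988Convergent, (2.50) p.264; Balaban1987RG1, (2.9) p.266; Balaban1985Averaging, Prop. 2 (54) p.26] -/
theorem uvLower_densOfRecord₁₃_of_plaquette_off_b0 (hζu : IsZetaUnity F N θ.ν θ.τ9.M θ.ζ) (hζa : IsZetaAbsLeOne F N θ.ν θ.τ9.M θ.ζ)
    (hε : 0 < θ.ν.εreg) (P : B12.RunParams) {k : ℕ} (hk : k ≤ (F.P P.K).m + (F.P P.K).K)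
    (hε3 : (143 * (((((F.P P.K).d + 4 : ℕ) : ℝ)) ^ 2 / 4) ^ 2) * θ.ν.εreg ≤ 1 / 3)
    (hε2 : 2 * θ.ν.εreg ≤ 2 * deltaSU (Fin N) / ((((F.P P.K).d + 4) * (F.P P.K).L : ℕ) : ℝ) ^ 2)
    (U : GaugeField (F.P P.K) k (SU N)) (p : Plaq (F.P P.K) k)
    (h₁ : ¬ IsB0 (F := F) (⟨p.src, p.μ⟩ : PBond (F.P P.K) k)) (h₂ : ¬ IsB0 (F := F) (⟨p.src.shift p.μ, p.ν⟩ : PBond (F.P P.K) k))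
    (h₃ : ¬ IsB0 (F := F) (⟨p.src.shift p.ν, p.μ⟩ : PBond (F.P P.K) k)) (h₄ : ¬ IsB0 (F := F) (⟨p.src, p.ν⟩ : PBond (F.P P.K) k))
    (hbig : 2 * θ.ν.εreg + 4 * θ.ε₂₉ ≤ dist1 (GaugeField.plaqHol U p)) (em : ℝ) :
    chiβOfRecord₁₃ F N θ P.K (gOfRecord₁₃ F N θ P) k U *
        Real.exp (-(1 / (gOfRecord₁₃ F N θ P k) ^ 2 * wilsonBGOfRecord F N θ.εbg P k U) - em * (Fintype.card (Site (F.P P.K) k) : ℝ)) ≤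
      densOfRecord₁₃ F N θ P k U := by
  have h0 : chiβOfRecord₁₃ F N θ P.K (gOfRecord₁₃ F N θ P) k U = 0 :=
    chiFix29OfRecord_eq_zero_of_plaquette_off_b0 θ.ν hk hε hε3 hε2 θ.ε₂₉ U p h₁ h₂ h₃ h₄ hbig
  rw [h0, zero_mul]
  exact densOfRecord₁₃_nonneg θ hζu hζa P k U

/-- **THE BY-NAME JUNCTION FOR A SUPPLIER OF THE LOWER HALF**: it suffices to prove the lower inequality at the configurations ALL of whose `b₀`-free plaquettes are
`(2εreg + 4ε₂₉)`-small — the complement is §3.  (The small-field content of [B16] Thm 1 ∕ [III] Cor. 3 lives on that locus; nothing of it is claimed here.)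
[cite: Balaban1989LargeFieldII, (0.1) pp.355–356; Balaban1988Convergent, (2.50) p.264 (bookkeeping)] -/
theorem uvLower_of_smallLocus (hζu : IsZetaUnity F N θ.ν θ.τ9.M θ.ζ) (hζa : IsZetaAbsLeOne F N θ.ν θ.τ9.M θ.ζ)
    (hε : 0 < θ.ν.εreg) (P : B12.RunParams) {k : ℕ} (hk : k ≤ (F.P P.K).m + (F.P P.K).K)
    (hε3 : (143 * (((((F.P P.K).d + 4 : ℕ) : ℝ)) ^ 2 / 4) ^ 2) * θ.ν.εreg ≤ 1 / 3)
    (hε2 : 2 * θ.ν.εreg ≤ 2 * deltaSU (Fin N) / ((((F.P P.K).d + 4) * (F.P P.K).L : ℕ) : ℝ) ^ 2) (em : ℝ)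
    (hsmall : ∀ U : GaugeField (F.P P.K) k (SU N),
      (∀ p : Plaq (F.P P.K) k, ¬ IsB0 (F := F) (⟨p.src, p.μ⟩ : PBond (F.P P.K) k) → ¬ IsB0 (F := F) (⟨p.src.shift p.μ, p.ν⟩ : PBond (F.P P.K) k) →
        ¬ IsB0 (F := F) (⟨p.src.shift p.ν, p.μ⟩ : PBond (F.P P.K) k) → ¬ IsB0 (F := F) (⟨p.src, p.ν⟩ : PBond (F.P P.K) k) →
        dist1 (GaugeField.plaqHol U p) < 2 * θ.ν.εreg + 4 * θ.ε₂₉) →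
      chiβOfRecord₁₃ F N θ P.K (gOfRecord₁₃ F N θ P) k U *
          Real.exp (-(1 / (gOfRecord₁₃ F N θ P k) ^ 2 * wilsonBGOfRecord F N θ.εbg P k U) - em * (Fintype.card (Site (F.P P.K) k) : ℝ)) ≤
        densOfRecord₁₃ F N θ P k U)
    (U : GaugeField (F.P P.K) k (SU N)) :
    chiβOfRecord₁₃ F N θ P.K (gOfRecord₁₃ F N θ P) k U *
        Real.exp (-(1 / (gOfRecord₁₃ F N θ P k) ^ 2 * wilsonBGOfRecord F N θ.εbg P k U) - em * (Fintype.card (Site (F.P P.K) k) : ℝ)) ≤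
      densOfRecord₁₃ F N θ P k U := by
  by_cases h : ∃ p : Plaq (F.P P.K) k, ¬ IsB0 (F := F) (⟨p.src, p.μ⟩ : PBond (F.P P.K) k) ∧ ¬ IsB0 (F := F) (⟨p.src.shift p.μ, p.ν⟩ : PBond (F.P P.K) k) ∧
      ¬ IsB0 (F := F) (⟨p.src.shift p.ν, p.μ⟩ : PBond (F.P P.K) k) ∧ ¬ IsB0 (F := F) (⟨p.src, p.ν⟩ : PBond (F.P P.K) k) ∧
      2 * θ.ν.εreg + 4 * θ.ε₂₉ ≤ dist1 (GaugeField.plaqHol U p)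
  · obtain ⟨p, h₁, h₂, h₃, h₄, hbig⟩ := h
    exact uvLower_densOfRecord₁₃_of_plaquette_off_b0 θ hζu hζa hε P hk hε3 hε2 U p h₁ h₂ h₃ h₄ hbig em
  · refine hsmall U fun p h₁ h₂ h₃ h₄ => lt_of_not_ge fun hbig => h ⟨p, h₁, h₂, h₃, h₄, hbig⟩

end Lower

/-! ## §4 (2.17) of record is `1` off the (2.12) solvable sets; the triviality regime `εreg ≤ ε_k` -/

section Chi217

variable (ν : Stage7Numerics) (g : ℕ → ℝ) (K k : ℕ)

/-- `η_k > 0`. [cite: Balaban1987RG1, (0.1) p.251 (bookkeeping)] -/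
theorem eta_pos : 0 < (F.P K).eta k := by
  rw [Params.eta]
  exact pow_pos (inv_pos.2 (by exact_mod_cast (F.P K).L_pos)) k

/-- **`χ_k(T_η)` OF RECORD IS `1` AT EVERY `V` ALL OF WHOSE CUBE DATA ARE UNSOLVABLE** (`0 < ε_k`): each cube factor is `1` by the junk branch of def-R's
(2.12) solution map (dag-n20-d's `chiSmall_ukBox_eq_one_of_not_solvable`, by name), assembled over the `LM₂R_k`-cube catalogue.  Print's `χ_k(T_η)` vanishes
at large fields; the object of record does not. [cite: Balaban1988Convergent, (2.17) p.257, (2.12) p.256 (typing convention)] -/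
theorem chiOfRecord_eq_one_of_forall_not_solvable (hεk : 0 < epsOfRecord ν g k) (V : GaugeField (F.P K) k (SU N))
    (hns : ∀ a ∈ cubeIndices (F.P K) (cubeSide (F.P K).L ν.M₂ (RkOfRecord (F.P K).L ν.r (g k)) k),
      ¬ ∃ U₀, IsMinimizer (avOfRecord F N K) {U | PlaqSmall (ν.εreg * (F.P K).eta k ^ 2) U}
        (Bj ν.M₁ (cubeEnl (F.P K) (cubeSide (F.P K).L ν.M₂ (RkOfRecord (F.P K).L ν.r (g k)) k) a 4) k)
        (avgFamily (avOfRecord F N K) (qsstarGIter0 k V)) U₀) :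
    chiOfRecord F N ν g K k V = 1 := by
  rw [chiOfRecord_eq_chi217, chi217_apply]
  exact Finset.prod_eq_one fun a ha =>
    chiSmall_ukBox_eq_one_of_not_solvable _ (mul_pos hεk (pow_pos (eta_pos (F := F) K k) 2)) (hns a ha)

/-- The history-indexed front factor `χ_k(Ω_k(s))` of record is likewise `1` at every `V` all of whose cube data INSIDE `Ω_k(s)` are unsolvable. [cite: Balaban1988Convergent, (2.17)–(2.18) p.257 (typing convention)] -/
theorem chiSeqOfRecord_eq_one_of_forall_not_solvable (M : ℕ) (hεk : 0 < epsOfRecord ν g k) (s : SeqOfRecord F ν M g K k) (V : GaugeField (F.P K) k (SU N))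
    (hns : ∀ a ∈ cubesIn (fun a : ↥(cubeIndices (F.P K) (cubeSide (F.P K).L ν.M₂ (RkOfRecord (F.P K).L ν.r (g k)) k)) =>
        cubeEnl (F.P K) (cubeSide (F.P K).L ν.M₂ (RkOfRecord (F.P K).L ν.r (g k)) k) a 0) (s.Ω k),
      ¬ ∃ U₀, IsMinimizer (avOfRecord F N K) {U | PlaqSmall (ν.εreg * (F.P K).eta k ^ 2) U}
        (Bj ν.M₁ (cubeEnl (F.P K) (cubeSide (F.P K).L ν.M₂ (RkOfRecord (F.P K).L ν.r (g k)) k) a 4) k)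
        (avgFamily (avOfRecord F N K) (qsstarGIter0 k V)) U₀) :
    chiSeqOfRecord F N ν M g K k s V = 1 := by
  rw [chiSeqOfRecord, chi218_apply]
  exact Finset.prod_eq_one fun a ha =>
    chiSmall_ukBox_eq_one_of_not_solvable _ (mul_pos hεk (pow_pos (eta_pos (F := F) K k) 2)) (hns a ha)

/-- **… IN PARTICULAR AT EVERY `V` WITH A `2εreg`-LARGE PLAQUETTE CORNERED IN EVERY CUBE's TOP-SCALE CONSTRAINT REGION** (`εreg` in [Av] Prop. 2's range,
`k ≤ m + K`): solvability would force `|V(∂p) − 1| < 2εreg` there (dag-n20-d's `dist1_plaqHol_lt_of_solvable`). [cite: Balaban1988Convergent, (2.17) p.257, p.267; Balaban1985Averaging, Prop. 2 (54) p.26] -/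
theorem chiOfRecord_eq_one_of_forall_largePlaquette (hk : k ≤ (F.P K).m + (F.P K).K) (hε : 0 < ν.εreg)
    (hε3 : (143 * (((((F.P K).d + 4 : ℕ) : ℝ)) ^ 2 / 4) ^ 2) * ν.εreg ≤ 1 / 3)
    (hε2 : 2 * ν.εreg ≤ 2 * deltaSU (Fin N) / ((((F.P K).d + 4) * (F.P K).L : ℕ) : ℝ) ^ 2)
    (hεk : 0 < epsOfRecord ν g k) (V : GaugeField (F.P K) k (SU N))
    (hbad : ∀ a ∈ cubeIndices (F.P K) (cubeSide (F.P K).L ν.M₂ (RkOfRecord (F.P K).L ν.r (g k)) k),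
      ∃ p : Plaq (F.P K) k,
        p.src ∈ pts k (maxDomT ν.M₁ (cubeEnl (F.P K) (cubeSide (F.P K).L ν.M₂ (RkOfRecord (F.P K).L ν.r (g k)) k) a 4) k) ∧
        p.src.shift p.μ ∈ pts k (maxDomT ν.M₁ (cubeEnl (F.P K) (cubeSide (F.P K).L ν.M₂ (RkOfRecord (F.P K).L ν.r (g k)) k) a 4) k) ∧
        p.src.shift p.ν ∈ pts k (maxDomT ν.M₁ (cubeEnl (F.P K) (cubeSide (F.P K).L ν.M₂ (RkOfRecord (F.P K).L ν.r (g k)) k) a 4) k) ∧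
        2 * ν.εreg ≤ dist1 (GaugeField.plaqHol V p)) :
    chiOfRecord F N ν g K k V = 1 := by
  refine chiOfRecord_eq_one_of_forall_not_solvable ν g K k hεk V fun a ha hsolv => ?_
  obtain ⟨p, h₀, hμ, hν, hbig⟩ := hbad a ha
  exact absurd (dist1_plaqHol_lt_of_solvable (F := F) (N := N) hk hε hε3 hε2 hsolv p h₀ hμ hν) (not_lt.2 hbig)

/-- **THE TRIVIALITY REGIME**: if `0 < εreg ≤ ε` then EVERY cube factor at threshold `ε·η_k²` is `1` — on the solvable branch the minimiser lies in the class
(`|∂U − 1| < εreg·η_k² ≤ ε·η_k²` on the whole fine torus), off it by junk. [cite: Balaban1988Convergent, (2.12) p.256, (2.17) p.257 (typing convention)] -/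
theorem chiSmall_ukBox_bgOfRecord_eq_one_of_εreg_le {ε : ℝ} (hreg : 0 < ν.εreg) (hle : ν.εreg ≤ ε) (M₁ : ℕ) (box4 : Set (Site (F.P K) 0))
    (S : Set (Plaq (F.P K) 0)) (V : GaugeField (F.P K) k (SU N)) :
    chiSmall S (ε * (F.P K).eta k ^ 2) (ukBox (bgOfRecord (avOfRecord F N K) {U | PlaqSmall (ν.εreg * (F.P K).eta k ^ 2) U}) M₁ box4 k V) = 1 := by
  have hη := pow_pos (eta_pos (F := F) K k) 2
  by_cases hsolv : ∃ U₀, IsMinimizer (avOfRecord F N K) {U | PlaqSmall (ν.εreg * (F.P K).eta k ^ 2) U} (Bj M₁ box4 k)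
      (avgFamily (avOfRecord F N K) (qsstarGIter0 k V)) U₀
  · have hreg' : PlaqSmall (ν.εreg * (F.P K).eta k ^ 2)
        (ukBox (bgOfRecord (avOfRecord F N K) {U | PlaqSmall (ν.εreg * (F.P K).eta k ^ 2) U}) M₁ box4 k V) :=
      (isMinimizer_ukBox_of_solvable (F := F) (N := N) hsolv).1
    unfold chiSmall
    rw [if_pos]
    exact fun q _ => lt_of_lt_of_le (hreg' q) (mul_le_mul_of_nonneg_right hle hη.le)
  · exact chiSmall_ukBox_eq_one_of_not_solvable S (mul_pos (lt_of_lt_of_le hreg hle) hη) hsolv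

/-- **★ `χ_k(T_η)` OF RECORD IS IDENTICALLY `1` IN THE REGIME `0 < εreg ≤ ε_k(g_k)`** (every `V`): the (2.17) character carries content ONLY through
`εreg > ε_k` — the witnesses' letters keep `B₃·ε_k ≤ εreg := a₀` (`Record13LettersOfThm1CCMW`), i.e. lie OUTSIDE this regime. [cite: Balaban1988Convergent, (2.17) p.257 (typing convention)] -/
theorem chiOfRecord_eq_one_of_εreg_le_eps (hreg : 0 < ν.εreg) (hle : ν.εreg ≤ epsOfRecord ν g k) (V : GaugeField (F.P K) k (SU N)) :
    chiOfRecord F N ν g K k V = 1 := by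
  rw [chiOfRecord_eq_chi217, chi217_apply]
  exact Finset.prod_eq_one fun a _ => chiSmall_ukBox_bgOfRecord_eq_one_of_εreg_le ν K k hreg hle _ _ _ V

end Chi217

/-! ## §5 What the row reads off def-B's level-`k` solvable set (b₀-touching large plaquettes allowed) -/

section ReadingA

variable (θ : Stage13Params F N)

/-- **`A^η_k(U) = 0` AT EVERY `U` WITH A `2ε`-LARGE PLAQUETTE** (`ε` in [Av] Prop. 2's range): solvability of the (0.21) problem within `bgReg(ε)` forces
`|U(∂p) − 1| < 2ε` everywhere (dag-n21-c's `plaqSmall_datum_of_ukExists`), so `U_k(U)` is the junk unit and `A^η(1) = 0`. [cite: Balaban1987RG1, (0.21)–(0.22) p.256 (typing convention); Balaban1985Averaging, Prop. 2 (54) p.26] -/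
theorem wilsonBGOfRecord_eq_zero_of_le_dist1 {ε : ℝ} (hε : 0 < ε) (P : B12.RunParams) (k : ℕ)
    (hε3 : (143 * (((((F.P P.K).d + 4 : ℕ) : ℝ)) ^ 2 / 4) ^ 2) * ε ≤ 1 / 3)
    (hε2 : 2 * ε ≤ 2 * deltaSU (Fin N) / ((((F.P P.K).d + 4) * (F.P P.K).L : ℕ) : ℝ) ^ 2)
    (U : GaugeField (F.P P.K) k (SU N)) (p : Plaq (F.P P.K) k) (hbig : 2 * ε ≤ dist1 (GaugeField.plaqHol U p)) :
    wilsonBGOfRecord F N ε P k U = 0 := by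
  have hn : ¬ UkExists F N P.K k ε U := fun h =>
    absurd (plaqSmall_datum_of_ukExists (F := F) (N := N) P.K k hε hε3 hε2 h p) (not_lt.2 hbig)
  rw [wilsonBGOfRecord_of_not F N ε P k hn]
  exact B15Claim189PinNonVacuity.wilsonAction4_unit 0

/-- **THE LOWER (UV₁₃) INEQUALITY OFF def-B's LEVEL-`k` SOLVABLE SET READS A-FREE**: at a `U` with SOME plaquette deviating by `≥ 2εbg` (distinguished bonds
allowed), the engines' lower conjunct is EQUIVALENT to `χβ_k(U)·exp(−em·|T₁^{(k)}|) ≤ ρ_k(U)` — no Wilson suppression left in it.  LOCATED reading (by §1 it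
is discharged unless every large plaquette of `U` touches a `b₀` bond; on that thin locus `χβ_k(U)` is decided by def-B's level-`(k+1)` map at `Ū`, not here).
[cite: Balaban1989LargeFieldII, (0.1) pp.355–356; Balaban1987RG1, (0.22) p.256 (typing convention)] -/
theorem uvLower_iff_of_le_dist1 (hε : 0 < θ.εbg) (P : B12.RunParams) (k : ℕ)
    (hε3 : (143 * (((((F.P P.K).d + 4 : ℕ) : ℝ)) ^ 2 / 4) ^ 2) * θ.εbg ≤ 1 / 3)
    (hε2 : 2 * θ.εbg ≤ 2 * deltaSU (Fin N) / ((((F.P P.K).d + 4) * (F.P P.K).L : ℕ) : ℝ) ^ 2)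
    (U : GaugeField (F.P P.K) k (SU N)) (p : Plaq (F.P P.K) k) (hbig : 2 * θ.εbg ≤ dist1 (GaugeField.plaqHol U p)) (em : ℝ) :
    (chiβOfRecord₁₃ F N θ P.K (gOfRecord₁₃ F N θ P) k U *
        Real.exp (-(1 / (gOfRecord₁₃ F N θ P k) ^ 2 * wilsonBGOfRecord F N θ.εbg P k U) - em * (Fintype.card (Site (F.P P.K) k) : ℝ)) ≤
      densOfRecord₁₃ F N θ P k U) ↔
    chiβOfRecord₁₃ F N θ P.K (gOfRecord₁₃ F N θ P) k U * Real.exp (-(em * (Fintype.card (Site (F.P P.K) k) : ℝ))) ≤ densOfRecord₁₃ F N θ P k U := by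
  rw [wilsonBGOfRecord_eq_zero_of_le_dist1 hε P k hε3 hε2 U p hbig, mul_zero, neg_zero, zero_sub]

end ReadingA

/-! ## §6 PLUGS INTO dag-n13-w3's (2.18)-LEAVES SOCKET (`…N13Cor3Repr218LeavesAtRecord13CoPH`, p592785): `ρ_k ≥ 0` keyed on the provisos; (L2) on the locus
(leaf (L1) at the record is dag-n13-w3's INTENT-6 `…N13Cor3LeafL1AtRecord13CoPH` — its `ζ ≥ 0` hypothesis holds at EVERY `Provisos₁₃CoPH` parameter by dag-n21-d's `zetaOfRecord_nonneg`) -/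

section Plugs

/-- **`ρ_k ≥ 0` OF RECORD UNDER THE CORE PROVISOS** (K1⁷ engines' keying). [cite: Balaban1988Convergent, (2.18) p.257 (bookkeeping)] -/
theorem densOfRecord₁₃_nonneg_of_provisos (θ : Stage13HParams F N) (h : θ.Provisos₁₃CoPH F N) (P : B12.RunParams) (k : ℕ)
    (U : GaugeField (F.P P.K) k (SU N)) : 0 ≤ densOfRecord₁₃ F N θ.toStage13Params P k U :=
  densOfRecord₁₃_nonneg θ.toStage13Params h.zetaUnity h.zetaAbs P k U

/-- **(L2)'s INEQUALITY ON THE LARGE-FIELD LOCUS, IN THE SOCKET's LETTERS**: at a `U` with a `b₀`-free plaquette deviating by `≥ 2εreg + 4ε₂₉`, the `hL2` inequality of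
dag-n13-w3's socket holds at `U` for EVERY candidate all-small index `s₀` and every `Em` (its left side vanishes, §1; its right side is `≥ 0`, (L1)).  So (L2)'s content is
on the complement, and `histTerm_pos_of_L2_of_chiβ_pos` never fires on this locus (`χβ_k(U) = 0` there); the right side is `≥ 0` by §2 (= dag-n13-w3's leaf (L1), INTENT-6). [cite: Balaban1988Convergent, Cor. 3 (2.50) p.264; Balaban1987RG1, (2.9) p.266] -/
theorem leafL2_on_locus_of_provisos (θ : Stage13HParams F N) (h : θ.Provisos₁₃CoPH F N) (hε : 0 < θ.ν.εreg) (P : B12.RunParams) {k : ℕ}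
    (hk : k ≤ (F.P P.K).m + (F.P P.K).K)
    (hε3 : (143 * (((((F.P P.K).d + 4 : ℕ) : ℝ)) ^ 2 / 4) ^ 2) * θ.ν.εreg ≤ 1 / 3)
    (hε2 : 2 * θ.ν.εreg ≤ 2 * deltaSU (Fin N) / ((((F.P P.K).d + 4) * (F.P P.K).L : ℕ) : ℝ) ^ 2)
    (s₀ : (reprOfRecord₁₃ F N θ.toStage13Params P k).Adm) (Em : ℝ) (U : GaugeField (F.P P.K) k (SU N)) (p : Plaq (F.P P.K) k)
    (h₁ : ¬ IsB0 (F := F) (⟨p.src, p.μ⟩ : PBond (F.P P.K) k)) (h₂ : ¬ IsB0 (F := F) (⟨p.src.shift p.μ, p.ν⟩ : PBond (F.P P.K) k))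
    (h₃ : ¬ IsB0 (F := F) (⟨p.src.shift p.ν, p.μ⟩ : PBond (F.P P.K) k)) (h₄ : ¬ IsB0 (F := F) (⟨p.src, p.ν⟩ : PBond (F.P P.K) k))
    (hbig : 2 * θ.ν.εreg + 4 * θ.ε₂₉ ≤ dist1 (GaugeField.plaqHol U p)) :
    chiβOfRecord₁₃ F N θ.toStage13Params P.K (gOfRecord₁₃ F N θ.toStage13Params P) k U *
        Real.exp (-(1 / (gOfRecord₁₃ F N θ.toStage13Params P k) ^ 2 * wilsonBGOfRecord F N θ.εbg P k U) - Em * (Fintype.card (Site (F.P P.K) k) : ℝ)) ≤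
      (reprOfRecord₁₃ F N θ.toStage13Params P k).χ s₀ U * (reprOfRecord₁₃ F N θ.toStage13Params P k).TexpA s₀ U := by
  have h0 : chiβOfRecord₁₃ F N θ.toStage13Params P.K (gOfRecord₁₃ F N θ.toStage13Params P) k U = 0 :=
    chiFix29OfRecord_eq_zero_of_plaquette_off_b0 θ.ν hk hε hε3 hε2 θ.ε₂₉ U p h₁ h₂ h₃ h₄ hbig
  rw [h0, zero_mul]
  exact histTerm_nonneg θ.toStage13Params h.zetaUnity h.zetaAbs P k s₀ U

end Plugs

end Summit.QuantumFields.YangMills.BalabanUVNodes.N13UVChiOffSolvableAtRecord13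

end
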